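import Summits.KontsevichZagierPeriods.KontsevichZagierPeriods.Theorems.SymplecticScissorsRealOnePeriodRelationsStubCellsAux
import Mathlib.Analysis.SpecialFunctions.Sqrt
import HarnessLib

/-!
# `RealOnePeriodRelations` (stmt-KontsevichZagierPeriods-10042), line `nash-retraction-thin-strip`,
# the bielliptic layer: the stub `stub_cubicOvalReciprocalCell`

`BiellipticLayer.stub_cubicOvalReciprocalCell`: a complete elliptic integral
`∫_{u₁}^{u₂} c du/√P(u)` over a real oval `(u₁, u₂)`, `0 < u₁ < u₂`, of the cubic
`P(u) = p₃u³ + p₂u² + p₁u + p₀` is ONE instance of Kontsevich–Zagier's rule (2) in dimension one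
away from the complete integral `∫_{1/u₂}^{1/u₁} c dv/√(p₀v⁴ + p₁v³ + p₂v² + p₃v)`: the chart is the
reciprocal `φ(u) = 1/u`, a decreasing bijection `(u₁, u₂) → (1/u₂, 1/u₁)` with `φ′(u) = −1/u²`,
and the exact identity `p₀u⁻⁴ + p₁u⁻³ + p₂u⁻² + p₃u⁻¹ = (u⁻²)² · P(u)` (`u ≠ 0`) gives
`c/√P(u) = (c/√(p₀v⁴ + p₁v³ + p₂v² + p₃v))|_{v = 1/u} · |φ′(u)|` on the oval. The push-forward
representation is BUILT by the landed one-dimensional rule-2 push-forward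
`HermiteRigidity.GenusTwoCycleTransfer.stub_pushforwardDimOne` (domain the image, integrand
`(r.integrand/|φ′|) ∘ Φ⁻¹`, integrability by Mathlib's change-of-variables criterion) with the
semialgebraic inverse of `…stub_semialgebraicInvFunOn`; `φ`, `φ′` are `ℚ`-semialgebraic on the
domain as rational functions of the coordinate. The relation produced is literally an element of
`KZ.changeOfVariablesRel` (not only of its closure `M₁`).

What is NOT here: positivity of the quartic `v·P*(v)` on the new oval and the algebraicity of its
end points `1/u₂`, `1/u₁` (immediate, and not part of the registered signature).

References: M. Kontsevich, D. Zagier, *Periods* (2001), §1.2 rule (2); A. Huber, G. Wüstholz,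
*Transcendence and linear relations of `1`-periods* (2022), §13.2.
-/

noncomputable section

open Set MeasureTheory
open Literature.NumberTheory.Transcendental Literature.ModelTheory.ExponentialFields

namespace Summit.KontsevichZagierPeriods.SymplecticScissors.RealOnePeriodRelations.BiellipticLayer

/-- The rational identity behind the reciprocal move of a cubic oval: for `u ≠ 0`,
`p₀u⁻⁴ + p₁u⁻³ + p₂u⁻² + p₃u⁻¹ = (u⁻²)² · (p₃u³ + p₂u² + p₁u + p₀)`, i.e.
`v⁴ P(1/v) = p₀v⁴ + p₁v³ + p₂v² + p₃v` read at `v = 1/u`.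
[cite: KontsevichZagier2001, §1.2 (rule 2)] -/
theorem cubicOvalReciprocalCell_identity {p₃ p₂ p₁ p₀ u : ℝ} (hu : u ≠ 0) :
    p₀ * u⁻¹ ^ 4 + p₁ * u⁻¹ ^ 3 + p₂ * u⁻¹ ^ 2 + p₃ * u⁻¹ =
      (u ^ 2)⁻¹ ^ 2 * (p₃ * u ^ 3 + p₂ * u ^ 2 + p₁ * u + p₀) := by
  field_simp
  ring

/-- Square roots of `cubicOvalReciprocalCell_identity` on the positive half-line:
`√(p₀u⁻⁴ + p₁u⁻³ + p₂u⁻² + p₃u⁻¹) = u⁻² · √(p₃u³ + p₂u² + p₁u + p₀)` for `u > 0` (both sides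
vanish, by Mathlib's junk value `√x = 0` for `x ≤ 0`, when `P(u) ≤ 0`).
[cite: KontsevichZagier2001, §1.2 (rule 2)] -/
theorem cubicOvalReciprocalCell_sqrt {p₃ p₂ p₁ p₀ u : ℝ} (hu : 0 < u) :
    Real.sqrt (p₀ * u⁻¹ ^ 4 + p₁ * u⁻¹ ^ 3 + p₂ * u⁻¹ ^ 2 + p₃ * u⁻¹) =
      (u ^ 2)⁻¹ * Real.sqrt (p₃ * u ^ 3 + p₂ * u ^ 2 + p₁ * u + p₀) := by
  rw [cubicOvalReciprocalCell_identity hu.ne', Real.sqrt_mul (sq_nonneg _),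
    Real.sqrt_sq (inv_nonneg.2 (sq_nonneg u))]

/-- The reciprocal move, registered interface with the unused hypotheses marked: push a
representation on
`{z | z 0 ∈ (u₁, u₂)}`, `0 < u₁ < u₂`, with integrand `c/√P` forward along `u ↦ u⁻¹` by the landed
one-dimensional rule-2 push-forward `HermiteRigidity.GenusTwoCycleTransfer.stub_pushforwardDimOne`
(chart `Φ p = (p 0)⁻¹`, derivative `−(p 0)⁻² • id`, semialgebraic inverse `Φ⁻¹` on the image by
`…stub_semialgebraicInvFunOn`); the image is `{z | z 0 ∈ (u₂⁻¹, u₁⁻¹)}` and the new integrand is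
`c/√(p₀v⁴ + p₁v³ + p₂v² + p₃v)` there. (Algebraicity of the coefficients, of `u₁, u₂, c`, and the
positivity of `P` on the oval, hypotheses of the registered interface, are not needed: the chart
and its derivative are `ℚ`-rational functions of the coordinate, and the integrand identity holds
with Mathlib's `Real.sqrt` whatever the sign of `P`.) [cite: KontsevichZagier2001, §1.2 (rule 2)] -/
theorem cubicOvalReciprocalCell_of (p₃ p₂ p₁ p₀ : ℝ) (_hp₃ : IsAlgebraic ℚ p₃)
    (_hp₂ : IsAlgebraic ℚ p₂) (_hp₁ : IsAlgebraic ℚ p₁) (_hp₀ : IsAlgebraic ℚ p₀) (u₁ u₂ c : ℝ)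
    (_hu₁ : IsAlgebraic ℚ u₁) (_hu₂ : IsAlgebraic ℚ u₂) (_hc : IsAlgebraic ℚ c) (h0 : 0 < u₁)
    (hlt : u₁ < u₂)
    (_hpos : ∀ u ∈ Set.Ioo u₁ u₂, 0 < p₃ * u ^ 3 + p₂ * u ^ 2 + p₁ * u + p₀)
    (r : KZ.IntegralRep 1) (hdom : r.domain = {z | z 0 ∈ Set.Ioo u₁ u₂})
    (hint : ∀ z ∈ r.domain, r.integrand z =
      c / Real.sqrt (p₃ * (z 0) ^ 3 + p₂ * (z 0) ^ 2 + p₁ * (z 0) + p₀)) :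
    ∃ r' : KZ.IntegralRep 1, r'.domain = {z | z 0 ∈ Set.Ioo u₂⁻¹ u₁⁻¹} ∧
      (∀ z ∈ r'.domain, r'.integrand z =
        c / Real.sqrt (p₀ * (z 0) ^ 4 + p₁ * (z 0) ^ 3 + p₂ * (z 0) ^ 2 + p₃ * (z 0))) ∧
      KZ.of r - KZ.of r' ∈ KZ.changeOfVariablesRel := by
  have hσ := r.isSemialgebraic_domain
  have hmem : ∀ p ∈ r.domain, p 0 ∈ Set.Ioo u₁ u₂ := fun p hp => by rw [hdom] at hp; exact hp
  have hgt : ∀ p ∈ r.domain, 0 < p 0 := fun p hp => h0.trans (hmem p hp).1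
  have hu₂ : 0 < u₂ := h0.trans hlt
  -- the chart `φ u = u⁻¹` and its derivative `φ′ u = −(u²)⁻¹` are semialgebraic on the domain
  have hφ : IsSemialgebraicFunOn ℚ r.domain (fun p => (p 0)⁻¹) :=
    (isSemialgebraicFunOn_apply hσ 0).fun_inv
  have hφ' : IsSemialgebraicFunOn ℚ r.domain (fun p => -((p 0) ^ 2)⁻¹) :=
    ((isSemialgebraicFunOn_apply hσ 0).fun_pow 2).fun_inv.fun_neg
  have hderiv : ∀ p ∈ r.domain, HasDerivAt (fun t : ℝ => t⁻¹) (-((p 0) ^ 2)⁻¹) (p 0) :=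
    fun p hp => hasDerivAt_inv (hgt p hp).ne'
  have hne : ∀ p ∈ r.domain, -((p 0) ^ 2)⁻¹ ≠ 0 := fun p hp =>
    neg_ne_zero.2 (inv_ne_zero (pow_ne_zero 2 (hgt p hp).ne'))
  have hinj : InjOn (fun p : Fin 1 → ℝ => fun _ : Fin 1 => (p 0)⁻¹) r.domain := by
    intro p _ p' _ h
    have h₀ : (p 0)⁻¹ = (p' 0)⁻¹ := congrFun h 0
    rw [KZ.eq_const_apply_zero p, KZ.eq_const_apply_zero p', inv_inj.mp h₀]
  have hΦ : IsSemialgebraicMapOn ℚ r.domain (fun p : Fin 1 → ℝ => fun _ : Fin 1 => (p 0)⁻¹) :=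
    IsSemialgebraicMapOn.of_forall hσ fun _ => hφ
  have hG := HermiteRigidity.GenusTwoCycleTransfer.stub_semialgebraicInvFunOn hΦ hinj
  obtain ⟨s, hs, hsi, hrel⟩ := HermiteRigidity.GenusTwoCycleTransfer.stub_pushforwardDimOne r
    (fun t => t⁻¹) (fun t => -(t ^ 2)⁻¹) _ hφ hφ' hderiv hne hG
    (fun p hp => hinj.leftInvOn_invFunOn hp)
  refine ⟨s, ?_, ?_, hrel⟩
  · -- the image of the oval `(u₁, u₂)` is the oval `(u₂⁻¹, u₁⁻¹)`
    rw [hs]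
    ext z
    constructor
    · rintro ⟨p, hp, rfl⟩
      have hp0 : 0 < p 0 := hgt p hp
      show (p 0)⁻¹ ∈ Set.Ioo u₂⁻¹ u₁⁻¹
      exact ⟨(inv_lt_inv₀ hu₂ hp0).2 (hmem p hp).2, (inv_lt_inv₀ hp0 h0).2 (hmem p hp).1⟩
    · intro hz
      have hz' : z 0 ∈ Set.Ioo u₂⁻¹ u₁⁻¹ := hz
      have hv : 0 < z 0 := (inv_pos.2 hu₂).trans hz'.1
      refine ⟨fun _ => (z 0)⁻¹, ?_, ?_⟩
      · rw [hdom]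
        show (z 0)⁻¹ ∈ Set.Ioo u₁ u₂
        exact ⟨(lt_inv_comm₀ hv h0).1 hz'.2, (inv_lt_comm₀ hu₂ hv).1 hz'.1⟩
      · rw [KZ.eq_const_apply_zero z]
        funext i
        show ((z 0)⁻¹)⁻¹ = z 0
        exact inv_inv (z 0)
  · -- the integrand of the push-forward is `c/√(p₀v⁴ + p₁v³ + p₂v² + p₃v)`
    intro z hz
    rw [hs] at hz
    obtain ⟨p, hp, rfl⟩ := hz
    have hx : 0 < p 0 := hgt p hp
    show s.integrand (fun _ => (p 0)⁻¹) =
      c / Real.sqrt (p₀ * (p 0)⁻¹ ^ 4 + p₁ * (p 0)⁻¹ ^ 3 + p₂ * (p 0)⁻¹ ^ 2 + p₃ * (p 0)⁻¹)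
    rw [hsi p hp, hint p hp, cubicOvalReciprocalCell_sqrt hx, abs_neg,
      abs_of_pos (inv_pos.2 (pow_pos hx 2)), div_div, mul_comm]

/-- STUB `stub_cubicOvalReciprocalCell` — **the reciprocal move on a positive cubic oval.**  A
complete elliptic integral `∫_{u₁}^{u₂} c du/√P(u)` over a real oval `(u₁, u₂)`, `0 < u₁ < u₂`, of
the cubic `P(u) = p₃u³ + p₂u² + p₁u + p₀` over `ℚ̄ ∩ ℝ` (`P > 0` inside) is ONE instance of
Kontsevich–Zagier's rule (2) — the chart `u = 1/v`, `v ∈ (1/u₂, 1/u₁)`, `|du| = dv/v²`,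
`v⁴P(1/v) = v·P*(v)` — away from the complete integral
`∫_{1/u₂}^{1/u₁} c dv/√(p₀v⁴ + p₁v³ + p₂v² + p₃v)` over a real oval of the quartic `v·P*(v)`:
`[r] − [r′] ∈ (2)`. [cite: KontsevichZagier2001, §1.2 (rule 2)] -/
theorem stub_cubicOvalReciprocalCell (p₃ p₂ p₁ p₀ : ℝ) (hp₃ : IsAlgebraic ℚ p₃) (hp₂ : IsAlgebraic ℚ p₂) (hp₁ : IsAlgebraic ℚ p₁)
    (hp₀ : IsAlgebraic ℚ p₀) (u₁ u₂ c : ℝ) (hu₁ : IsAlgebraic ℚ u₁) (hu₂ : IsAlgebraic ℚ u₂) (hc : IsAlgebraic ℚ c)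
    (h0 : 0 < u₁) (hlt : u₁ < u₂) (hpos : ∀ u ∈ Set.Ioo u₁ u₂, 0 < p₃ * u ^ 3 + p₂ * u ^ 2 + p₁ * u + p₀)
    (r : KZ.IntegralRep 1) (hdom : r.domain = {z | z 0 ∈ Set.Ioo u₁ u₂})
    (hint : ∀ z ∈ r.domain, r.integrand z = c / Real.sqrt (p₃ * (z 0) ^ 3 + p₂ * (z 0) ^ 2 + p₁ * (z 0) + p₀)) :
    ∃ r' : KZ.IntegralRep 1, r'.domain = {z | z 0 ∈ Set.Ioo u₂⁻¹ u₁⁻¹} ∧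
      (∀ z ∈ r'.domain, r'.integrand z = c / Real.sqrt (p₀ * (z 0) ^ 4 + p₁ * (z 0) ^ 3 + p₂ * (z 0) ^ 2 + p₃ * (z 0))) ∧
      KZ.of r - KZ.of r' ∈ KZ.changeOfVariablesRel :=
  cubicOvalReciprocalCell_of p₃ p₂ p₁ p₀ hp₃ hp₂ hp₁ hp₀ u₁ u₂ c hu₁ hu₂ hc h0 hlt hpos r hdom hint

end Summit.KontsevichZagierPeriods.SymplecticScissors.RealOnePeriodRelations.BiellipticLayer

end
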